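import Mathlib.RingTheory.Discriminant
import Mathlib.RingTheory.Norm.Basic
import Mathlib.RingTheory.Trace.Basic
import Mathlib.LinearAlgebra.BilinearForm.Properties
import HarnessLib

set_option linter.dupNamespace false

/-!
# Weil-type family coverage — the TWISTED TRACE-FORM DETERMINANT (census block «### b06.31» (c), the algebraic core of the
«Pfaffian law» for the component of a polarised CM point of Weil type)

research route conditional on HC_CM; not a corollary; Q11.4-sentence-2 already refuted in dim ≥ 3.

Ring 2, WEIL-TYPE FAMILY-COVERAGE CENSUS (`HOME/WEIL-FAMILY-COVERAGE.md` `## b06`, block b06.31, owner ring2-b06, gen 109).  SETTING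
(informal, NOT formalised here): for a CM field `L ⊃ K = ℚ(θ)` (`θ² = D < 0`), a `K`-balanced CM type `Φ`, the CM torus
`X = ℂ^Φ/Φ(𝔪)` and a `Φ`-positive skew `ξ ∈ L`, the `K`-hermitian form of the polarised triple `(X, K, E_ξ)`,
`E_ξ(x,y) = Tr_{L/ℚ}(ξ x ȳ)`, is `H(x,y) = θ⁻¹ Tr_{L/K}(ξ x ȳ)` (Deligne, LNM 900, Lemma 4.6); on a `ℚ`-basis `b` of the maximal
real subfield `L⁺` (a `K`-basis of `L = L⁺ ⊗ K`) its Gram matrix is the TWISTED TRACE MATRIX `(Tr_{L⁺/ℚ}(η bᵢ bⱼ))ᵢⱼ` of the real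
element `η = ξ/θ ∈ L⁺`, because `Tr_{L/K}` restricts to `Tr_{L⁺/ℚ}` on `L⁺`.  THIS FILE proves, for an arbitrary commutative
algebra `L` over a commutative ring `K` with a finite basis `b`, the identity that turns that Gram determinant into a norm:

  `det (Tr_{L/K}(η · bᵢ · bⱼ))ᵢⱼ = N_{L/K}(η) · discr_K(b)`,

i.e. the determinant of the trace form twisted by `η` is the norm of `η` times the discriminant of the basis (matrix form:
`toMatrix b (traceForm ∘ (η · −)) = (toMatrix b (η · −))ᵀ · traceMatrix b`).  Consequence recorded in the census (S-pencil there, not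
here): the van Geemen discriminant class of `(X, K, E_ξ)` is `a ≡ (−1)ⁿ det H ≡ d_{L⁺} · √N_{L/ℚ}(ξ) ≡ N_{L⁺/ℚ}(𝔣₀) · √N(𝔡_{L/L⁺})`
modulo `Nm K^×`, `𝔣₀` the Shimura type of `E_ξ` — «the component is the class of the Pfaffian» at every cyclotomic level.
What is NOT here: CM fields, hermitian forms, polarisations, Hodge classes; `HC_CM` is used nowhere.  No `sorry`, no definitions.
[folklore] (linear algebra: `G = Mᵀ T` with `M` the matrix of multiplication by `η` and `T` the trace matrix).
-/

namespace Summit.HodgeConjecture.HodgeConjecture.Ring2.WeilCoverage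

open Matrix

variable {K L : Type*} [CommRing K] [CommRing L] [Algebra K L] {ι : Type*} [Fintype ι] [DecidableEq ι]

/-- TWISTED TRACE-FORM DETERMINANT, bilinear-form version: for a finite `K`-basis `b` of the commutative `K`-algebra `L` and any
`η ∈ L`, the matrix on `b` of the bilinear form `(x, y) ↦ Tr_{L/K}(η x · y)` (the trace form composed on the left with
multiplication by `η`) has determinant `N_{L/K}(η) · discr_K(b)`.  [folklore]
research route conditional on HC_CM; not a corollary; Q11.4-sentence-2 already refuted in dim ≥ 3. -/
theorem det_toMatrix_traceForm_compLeft_lmul (b : Module.Basis ι K L) (η : L) :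
    (LinearMap.BilinForm.toMatrix b ((Algebra.traceForm K L).compLeft (Algebra.lmul K L η))).det =
      Algebra.norm K η * Algebra.discr K b := by
  rw [LinearMap.BilinForm.toMatrix_compLeft, Matrix.det_mul, Matrix.det_transpose, LinearMap.det_toMatrix,
    Algebra.norm_apply, Algebra.discr_def, Algebra.traceMatrix_of_basis]

/-- TWISTED TRACE-FORM DETERMINANT, entrywise version: `det (Tr_{L/K}(η · bᵢ · bⱼ))ᵢⱼ = N_{L/K}(η) · discr_K(b)` for every finite
`K`-basis `b` of `L` and every `η ∈ L` (for `η = 1` this is the definition of the discriminant).  [folklore]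
research route conditional on HC_CM; not a corollary; Q11.4-sentence-2 already refuted in dim ≥ 3. -/
theorem det_trace_mul_basis (b : Module.Basis ι K L) (η : L) :
    (Matrix.of fun i j => Algebra.trace K L (η * b i * b j)).det = Algebra.norm K η * Algebra.discr K b := by
  have h : (Matrix.of fun i j => Algebra.trace K L (η * b i * b j)) =
      LinearMap.BilinForm.toMatrix b ((Algebra.traceForm K L).compLeft (Algebra.lmul K L η)) := by
    ext i j
    simp [LinearMap.BilinForm.toMatrix_apply, LinearMap.BilinForm.compLeft_apply, Algebra.traceForm_apply, mul_assoc]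
  rw [h]
  exact det_toMatrix_traceForm_compLeft_lmul b η

/-- The case used by the census: a unit `η` of norm `±1` (e.g. a real unit of a CM field adjusting the sign pattern of a
polarisation) does not change the twisted trace determinant beyond the sign `N(η)`: `det (Tr(η bᵢ bⱼ)) = N(η) · discr(b)` with
`N(η)² = 1` when `N(η) = 1 ∨ N(η) = -1`.  [folklore]
research route conditional on HC_CM; not a corollary; Q11.4-sentence-2 already refuted in dim ≥ 3. -/
theorem det_trace_mul_basis_sq_of_norm_sq_eq_one (b : Module.Basis ι K L) (η : L) (hη : Algebra.norm K η ^ 2 = 1) :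
    ((Matrix.of fun i j => Algebra.trace K L (η * b i * b j)).det) ^ 2 = (Algebra.discr K b) ^ 2 := by
  rw [det_trace_mul_basis, mul_pow, hη, one_mul]

end Summit.HodgeConjecture.HodgeConjecture.Ring2.WeilCoverage
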